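/-
Copyright (c) 2026 the pub-hodgecm-mathlib formalisation cell (harness21).  Prover seat hodgecm-mathlib-K2E3-p20 (g3), Track B «K2-LIT» ∕ h413 =
`stmt-HodgeConjecture-24833`, line `K2_E3_EllipticInputs`, unit U12 «Characters», socket #11 road (SC-an) «supercuspidal characters are locally
integrable near semisimple points», brick (T20-b) of the CENSUS-Thm20 (K2E3-p20 (g3), 2026-09-04), PART 2 (CM, supercuspidal): the orbital slice
`f_γ(x) = θ(x γ x⁻¹)` of a supercuspidal coefficient `θ` of `U(Φ₃)(L⁺_v)` (`v` non-split) at a regular diagonal `γ` lies in Harish-Chandra's space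
`Φ_C` (continuous, right-`T`-invariant, supported on `C·T`, `N`-cuspidal).  Line lead K2E3-p20 (g3) (dealer K2E3-plan (g2), D17 2026-09-04T01:34:25Z);
REPORT-FIRST 2026-09-04T01:45:50Z.
-/
import Summits.HodgeConjecture.HodgeConjecture.Theorems.K2E3UnipotentConjTwistBochner             -- ★-bound part 1 (this seat): Lemma 22 Bochner form, slice cuspidality, Lemma 14 reading
import Literature.NumberTheory.Rogawski1990.U3SupercuspFormUnipotentIntegralCM               -- ★ `integral_dual_apply_cmBorelTriple_N_eq_zero_of_isSupercuspidal`, `exists_compactOpen_subgroups_exhausting_cmBorelTriple_N`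
import Summits.HodgeConjecture.HodgeConjecture.Theorems.K2E1SupercuspidalCoefficientNCuspidal  -- ★ `integrable_∕continuous_sesqForm_apply_translate_restrict`, `isClosed_coe_cmBorelTriple_N`
import Summits.HodgeConjecture.HodgeConjecture.Theorems.F0P3bCentralCharacterUnitaryNonsplit   -- ★ `isCompact_center_cmLocal_of_nonsplit`
import Summits.HodgeConjecture.HodgeConjecture.Theorems.F0P3cStCharTSWeylHypFibre             -- ★ `isUnit_sub_of_isRegularElt_glDiagonal`
import Literature.NumberTheory.Automorphic.RegularDiagonalCentralizer                         -- ★ `mem_torusU_iff_mem_centralizer_of_isUnit_sub` (`Z(t) = T`)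
import Literature.NumberTheory.Automorphic.ConjugationProperOnRegularCompactaLocal             -- ★ Harish-Chandra's Lemma 14 `isCompact_image_mk_setOf_exists_conj_mem_cmDatum_local`
import Literature.NumberTheory.Automorphic.UnitaryGroupPureTensorEulerProduct                  -- ★ `locallyCompactSpace_gl_adicCompletion`, `secondCountableTopology_gl_adicCompletion`
import Literature.NumberTheory.Automorphic.SmoothRepresentationLocallyConstant                 -- ★ `Representation.IsSmooth.isLocallyConstant_apply`
import Literature.MeasureTheory.Group.HaarUnionCompactSubgroups                               -- ★ `isMulRightInvariant_of_iUnion_isCompact_subgroup`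
import Literature.NumberTheory.Automorphic.HeisenbergChartAtNonsplitPlace                    -- ★ `isUnit_two_localRing`
import HarnessLib

/-!
# K2_E3 road (h413), socket #11 (SC-an), brick (T20-b) part 2: THE ORBITAL SLICE OF A SUPERCUSPIDAL COEFFICIENT OF `U(Φ₃)(L⁺_v)` AT A REGULAR
# DIAGONAL ELEMENT IS A HARISH-CHANDRA CUSP FORM — `f_γ(x) = θ(xγx⁻¹) ∈ Φ_C`

Cell `pub/hodgecm-mathlib`, Track B «K2-LIT», crux H413 = `stmt-HodgeConjecture-24833` (`--supports … --as helper`, count-neutral).  CENSUS-Thm20 §2: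
for `g` regular NON-elliptic with Cartan `T ∋ γ`, the two consumers of THEOREM 20 along ★ `K2E3HeightBallExhaustion` (the limit `hlim` of ★
`K2E3CharLocIntNearSemisimpleSupercuspidalOfTruncated`, the cancellation `hcanc` of ★ `K2E3SupercuspidalTruncatedCharDominationOfBricks`) feed it
`f_γ(x) := θ(x γ x⁻¹)`, which must lie in `Φ_C` [HarishChandra1970, VII §2 p. 70]: (i) `f(xa) = f(x)` (`a ∈ A`), `supp f ⊆ C·A`; (ii)
`∫_{N'} f(x n') dn' = 0`.  At rank one (`U(2,1) = U(Φ₃)(L⁺_v)`, `v` non-split) with `A := T` (right-`T`-invariance is STRONGER than print's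
right-`A`-invariance; `T = A·T¹`, `T¹` compact), ALL INPUTS ★ (generic half ★-bound `K2E3UnipotentConjTwistBochner`):

* `integral_coeff_translate_cmBorelN_eq_zero_of_isSupercuspidal` — two-sided `N`-cuspidality of `B u' (ρ(a n b) u)` for EVERY Haar measure of
  `N(L⁺_v)` (★ `Rogawski1990.integral_dual_apply_cmBorelTriple_N_eq_zero_of_isSupercuspidal` with right-invariance and integrability discharged);
* **`integral_coeff_conj_cmBorelN_eq_zero_of_isSupercuspidal`** — THE HEAD: `∫_N B u' (ρ(a · nγn⁻¹ · b) u) dn = 0` for `γ = diag d` with `IsRegularElt γ`;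
  `integral_coeff_conj_conj_cmBorelN_eq_zero_of_isSupercuspidal` — its `w`-twin (`N̄ = w₀Nw₀` parametrised by `N`);
* the SLICE PACKAGE = print's `f_γ ∈ Φ_C`: `continuous_coeff_conj`, `coeff_conj_mul_eq_of_mem_torusU` (right-`T`-invariance, `Z(γ) = T`),
  `integral_coeff_slice_cmBorelN_eq_zero_of_isSupercuspidal` (`∫_N f_γ(x n) dn = 0`), `exists_isCompact_support_coeff_conj_subset_mul_torusU`
  (`supp f_γ ⊆ C·T`, Harish-Chandra's Lemma 14).

HONEST LABEL: HC_CM is proved only modulo the 7 printed citations (2 remaining named inputs: hLiu418 = stmt-HodgeConjecture-24832, h413 =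
stmt-HodgeConjecture-24833) until rung 0 closes; this file is a count-neutral helper.

## References
* [HarishChandra1970] Harish-Chandra (notes by G. van Dijk), *Harmonic Analysis on Reductive p-adic Groups*, LNM 162 (1970), Part I §3 Lemma 14 p. 9;
  Part V §6 Lemma 22 p. 42; Part VII §2 Theorem 20 p. 70, §8 pp. 80–84.
* [Rogawski1990] J. D. Rogawski, *Automorphic Representations of Unitary Groups in Three Variables*, Ann. of Math. Stud. 123 (1990), §1.10 p. 9, §3.6 p. 31,
  §4.9 p. 54, §12.2 p. 173.
* [Casselman1995] W. Casselman, *Introduction to the theory of admissible representations of p-adic reductive groups* (1995), Prop. 1.4.4, Thm. 5.3.1.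
-/

set_option autoImplicit false
-- the mandated namespace repeats the single-problem summit's segment (`HodgeConjecture.HodgeConjecture`)
set_option linter.dupNamespace false

noncomputable section

open MeasureTheory Measure Set Filter Topology
open scoped NNReal ENNReal Pointwise Matrix MatrixGroups

namespace Summit.HodgeConjecture.HodgeConjecture.Cruxes.H413.K2E3SupercuspOrbitalSliceCuspidal

open K2E3UnipotentConjTwistBochner

/-! ## §3 The CM group `U(Φ₃)(L⁺_v)` at a NON-SPLIT place: supercuspidal coefficients -/

section CM

open NumberField IsDedekindDomain
open Literature.NumberTheory.Automorphic Literature.NumberTheory.Automorphic.UnitaryGroup Literature.NumberTheory.Rogawski1990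

variable (L : Type) [Field L] [NumberField L] [IsCMField L] (v : HeightOneSpectrum (𝓞 ↥(maximalRealSubfield L)))

set_option synthInstance.maxHeartbeats 400000 in
set_option maxHeartbeats 1600000 in
-- instance-term unification on the CM local carriers (as in ★ `UnitaryGroupHeisenbergRingRegularTwist` §4)
/-- **SUPERCUSPIDAL COEFFICIENTS ARE TWO-SIDEDLY `N`-CUSPIDAL FOR EVERY HAAR MEASURE OF `N(L⁺_v)`** (`v` non-split): for `r` irreducible smooth with
`r.ρ` supercuspidal, a `U`-invariant sesquilinear form `B`, any Haar measure `μ_N` of `N = (cmBorelTriple L 3 v).N` and all `a, b, u, u'`: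
`∫_N B u' (ρ(a n b) u) dμ_N(n) = 0`.  ★ `Rogawski1990.integral_dual_apply_cmBorelTriple_N_eq_zero_of_isSupercuspidal` with its two side conditions
discharged: right-invariance of `μ_N` (★ `isMulRightInvariant_of_iUnion_isCompact_subgroup` ∘ ★ exhaustion) and integrability (★
`integrable_sesqForm_apply_translate_restrict`, compact centre ★ `isCompact_center_cmLocal_of_nonsplit`, `N` closed ★ `isClosed_coe_cmBorelTriple_N`).
[cite: HarishChandra1970, Part I §3 p. 9] [cite: Casselman1995, Thm. 5.3.1] [cite: Rogawski1990, §12.2 p. 173] -/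
theorem integral_coeff_translate_cmBorelN_eq_zero_of_isSupercuspidal (hns : ∀ w : PlacesOver L v, IsCMField.complexConj L • w.1 = w.1)
    [MeasurableSpace ↥(cmBorelTriple L 3 v).N] [BorelSpace ↥(cmBorelTriple L 3 v).N]
    (μN : Measure ↥(cmBorelTriple L 3 v).N) [IsHaarMeasure μN]
    (r : SmoothIrrep ↥(unitaryGroupOfForm (conjLocal L (IsCMField.complexConj L) v) (cmLocalForm L 3 v))) (hsc : r.ρ.IsSupercuspidal)
    (B : r.V →ₗ⋆[ℂ] r.V →ₗ[ℂ] ℂ)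
    (hBinv : ∀ (g : ↥(unitaryGroupOfForm (conjLocal L (IsCMField.complexConj L) v) (cmLocalForm L 3 v))) (x y : r.V), B (r.ρ g x) (r.ρ g y) = B x y)
    (a b : ↥(unitaryGroupOfForm (conjLocal L (IsCMField.complexConj L) v) (cmLocalForm L 3 v))) (u u' : r.V) :
    ∫ n, B u' (r.ρ (a * (n : ↥(unitaryGroupOfForm (conjLocal L (IsCMField.complexConj L) v) (cmLocalForm L 3 v))) * b) u) ∂μN = 0 := by
  haveI : LocallyCompactSpace ↥(unitaryGroupOfForm (conjLocal L (IsCMField.complexConj L) v) (cmLocalForm L 3 v)) :=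
    locallyCompactSpace_local (IsCMField.complexConj L) 3 _ v
  haveI : SecondCountableTopology ↥(unitaryGroupOfForm (conjLocal L (IsCMField.complexConj L) v) (cmLocalForm L 3 v)) :=
    secondCountableTopology_local (IsCMField.complexConj L) 3 _ v
  haveI : LocallyCompactSpace ↥(cmBorelTriple L 3 v).N := (isClosed_coe_cmBorelTriple_N L 3 v).isClosedEmbedding_subtypeVal.locallyCompactSpace
  obtain ⟨Nj, -, hc, -, hex⟩ := exists_compactOpen_subgroups_exhausting_cmBorelTriple_N L v hns
  haveI : μN.IsMulRightInvariant := Literature.MeasureTheory.Group.isMulRightInvariant_of_iUnion_isCompact_subgroup μN Nj hc hex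
  exact integral_dual_apply_cmBorelTriple_N_eq_zero_of_isSupercuspidal L v hns r ((IrrClass.isSupercuspidal_mk r).2 hsc) μN (B u') u a b
    (K2E1SupercuspidalCoefficientNCuspidal.integrable_sesqForm_apply_translate_restrict r.ρ (cmBorelTriple L 3 v).N μN hsc
      (F0P3bCentralCharacterUnitaryNonsplit.isCompact_center_cmLocal_of_nonsplit L 3 v hns) r.isSmooth hBinv (isClosed_coe_cmBorelTriple_N L 3 v)
      a b u u')

/-- **The restricted two-sided coefficient `n ↦ B u' (ρ(a n b) u)` is a.e.-strongly measurable** (continuous, ★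
`continuous_sesqForm_apply_translate_restrict`). [cite: Casselman1995, Prop. 1.4.4] -/
theorem aestronglyMeasurable_coeff_translate_cmBorelN [MeasurableSpace ↥(cmBorelTriple L 3 v).N] [BorelSpace ↥(cmBorelTriple L 3 v).N]
    (μN : Measure ↥(cmBorelTriple L 3 v).N)
    (r : SmoothIrrep ↥(unitaryGroupOfForm (conjLocal L (IsCMField.complexConj L) v) (cmLocalForm L 3 v))) (B : r.V →ₗ⋆[ℂ] r.V →ₗ[ℂ] ℂ)
    (a b : ↥(unitaryGroupOfForm (conjLocal L (IsCMField.complexConj L) v) (cmLocalForm L 3 v))) (u u' : r.V) :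
    AEStronglyMeasurable (fun n : ↥(cmBorelTriple L 3 v).N =>
      B u' (r.ρ (a * (n : ↥(unitaryGroupOfForm (conjLocal L (IsCMField.complexConj L) v) (cmLocalForm L 3 v))) * b) u)) μN :=
  (K2E1SupercuspidalCoefficientNCuspidal.continuous_sesqForm_apply_translate_restrict r.ρ (cmBorelTriple L 3 v).N (B := B) r.isSmooth a b u u').aestronglyMeasurable

set_option synthInstance.maxHeartbeats 400000 in
set_option maxHeartbeats 1600000 in
-- instance-term unification on the CM local carriers
/-- **THE HEAD — `∫_N θ(a · n γ n⁻¹ · b) dn = 0` FOR A SUPERCUSPIDAL COEFFICIENT `θ = B u' (ρ(·) u)` AND A REGULAR DIAGONAL `γ`** (`v` non-split,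
`U(2,1) = U(Φ₃)(L⁺_v)`, `N = N(L⁺_v)` with ANY Haar measure, `γ = diag d` with `IsRegularElt γ` — ★ `isUnit_sub_of_isRegularElt_glDiagonal` makes
`d₀⁻¹d₁ − 1`, `d₀⁻¹d₂ − 1` units).  Lemma 22 (§2, CM instance as in ★ `lintegral_conj_cmBorel_eq_mul_lintegral_mul`) ∘ the cusp condition
(`integral_coeff_translate_cmBorelN_eq_zero_of_isSupercuspidal`). [cite: HarishChandra1970, Part V §6 Lemma 22 p. 42; Part VII §2 p. 70 (ii)]
[cite: Rogawski1990, §4.9 p. 54] -/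
theorem integral_coeff_conj_cmBorelN_eq_zero_of_isSupercuspidal (hns : ∀ w : PlacesOver L v, IsCMField.complexConj L • w.1 = w.1)
    [MeasurableSpace ↥(cmBorelTriple L 3 v).N] [BorelSpace ↥(cmBorelTriple L 3 v).N]
    (μN : Measure ↥(cmBorelTriple L 3 v).N) [IsHaarMeasure μN]
    (r : SmoothIrrep ↥(unitaryGroupOfForm (conjLocal L (IsCMField.complexConj L) v) (cmLocalForm L 3 v))) (hsc : r.ρ.IsSupercuspidal)
    (B : r.V →ₗ⋆[ℂ] r.V →ₗ[ℂ] ℂ)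
    (hBinv : ∀ (g : ↥(unitaryGroupOfForm (conjLocal L (IsCMField.complexConj L) v) (cmLocalForm L 3 v))) (x y : r.V), B (r.ρ g x) (r.ρ g y) = B x y)
    (t : ↥(unitaryGroupOfForm (conjLocal L (IsCMField.complexConj L) v) (cmLocalForm L 3 v))) {d : Fin 3 → (LocalRing L v)ˣ}
    (hd : glDiagonal 3 (LocalRing L v) d = (t : GL (Fin 3) (LocalRing L v))) (hreg : IsRegularElt (t : GL (Fin 3) (LocalRing L v)))
    (a b : ↥(unitaryGroupOfForm (conjLocal L (IsCMField.complexConj L) v) (cmLocalForm L 3 v))) (u u' : r.V) :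
    ∫ n, B u' (r.ρ (a * ((n : ↥(unitaryGroupOfForm (conjLocal L (IsCMField.complexConj L) v) (cmLocalForm L 3 v))) * t *
      (n : ↥(unitaryGroupOfForm (conjLocal L (IsCMField.complexConj L) v) (cmLocalForm L 3 v)))⁻¹) * b) u) ∂μN = 0 := by
  haveI : LocallyCompactSpace ↥(unitaryGroupOfForm (conjLocal L (IsCMField.complexConj L) v) (cmLocalForm L 3 v)) :=
    locallyCompactSpace_local (IsCMField.complexConj L) 3 _ v
  haveI : SecondCountableTopology ↥(unitaryGroupOfForm (conjLocal L (IsCMField.complexConj L) v) (cmLocalForm L 3 v)) :=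
    secondCountableTopology_local (IsCMField.complexConj L) 3 _ v
  haveI : SecondCountableTopology (LocalRing L v) := secondCountableTopology_localRing (E := L) v
  letI : MeasurableSpace (LocalRing L v) := borel _
  haveI : BorelSpace (LocalRing L v) := ⟨rfl⟩
  letI : Invertible (2 : LocalRing L v) := (isUnit_two_localRing L v).invertible
  have hreg' : IsRegularElt (glDiagonal 3 (LocalRing L v) d) := by rw [hd]; exact hreg
  have ha : IsUnit ((((d 0)⁻¹ * d 1 : (LocalRing L v)ˣ) : LocalRing L v) - 1) :=
    isUnit_coe_inv_mul_sub_one (F0P3cStCharTSWeylHypFibre.isUnit_sub_of_isRegularElt_glDiagonal hreg' (by decide))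
  have hb : IsUnit ((((d 0)⁻¹ * d 2 : (LocalRing L v)ˣ) : LocalRing L v) - 1) :=
    isUnit_coe_inv_mul_sub_one (F0P3cStCharTSWeylHypFibre.isUnit_sub_of_isRegularElt_glDiagonal hreg' (by decide))
  have ht : t ∈ torusU (conjLocal L (IsCMField.complexConj L) v) (cmLocalForm L 3 v) := (mem_torusU_iff t).2 ⟨d, hd⟩
  exact integral_conj_unipotentU_eq_zero_of_forall_integral_eq_zero (conjLocal L (IsCMField.complexConj L) v) (conjLocal_conjLocal_cm L v)
    (continuous_conjLocal L (IsCMField.complexConj L) v) (cmLocalForm_eq_over L 3 v) μN ⟨t, ht⟩ hd ha hb (fun g => B u' (r.ρ g u))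
    (fun a' b' => integral_coeff_translate_cmBorelN_eq_zero_of_isSupercuspidal L v hns μN r hsc B hBinv a' b' u u')
    (fun a' b' => aestronglyMeasurable_coeff_translate_cmBorelN L v μN r B a' b' u u') a b

set_option synthInstance.maxHeartbeats 400000 in
set_option maxHeartbeats 1600000 in
-- instance-term unification on the CM local carriers
/-- **THE `w`-TWIN AT `U(Φ₃)(L⁺_v)`**: for any `t, w` with `w⁻¹ t w = diag d'` REGULAR, `∫_N θ(a · (w n w⁻¹) t (w n w⁻¹)⁻¹ · b) dn = 0` for the
supercuspidal coefficient `θ = B u' (ρ(·) u)` — the `N̄ = w₀ N w₀`-cuspidality of the slice, parametrised by `N`.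
[cite: HarishChandra1970, Part VII §2 p. 70 (ii)] [cite: Rogawski1990, §1.10 p. 9] -/
theorem integral_coeff_conj_conj_cmBorelN_eq_zero_of_isSupercuspidal (hns : ∀ w : PlacesOver L v, IsCMField.complexConj L • w.1 = w.1)
    [MeasurableSpace ↥(cmBorelTriple L 3 v).N] [BorelSpace ↥(cmBorelTriple L 3 v).N]
    (μN : Measure ↥(cmBorelTriple L 3 v).N) [IsHaarMeasure μN]
    (r : SmoothIrrep ↥(unitaryGroupOfForm (conjLocal L (IsCMField.complexConj L) v) (cmLocalForm L 3 v))) (hsc : r.ρ.IsSupercuspidal)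
    (B : r.V →ₗ⋆[ℂ] r.V →ₗ[ℂ] ℂ)
    (hBinv : ∀ (g : ↥(unitaryGroupOfForm (conjLocal L (IsCMField.complexConj L) v) (cmLocalForm L 3 v))) (x y : r.V), B (r.ρ g x) (r.ρ g y) = B x y)
    (t w t' : ↥(unitaryGroupOfForm (conjLocal L (IsCMField.complexConj L) v) (cmLocalForm L 3 v))) (hw : w⁻¹ * t * w = t')
    {d' : Fin 3 → (LocalRing L v)ˣ} (hd' : glDiagonal 3 (LocalRing L v) d' = (t' : GL (Fin 3) (LocalRing L v)))
    (hreg' : IsRegularElt (t' : GL (Fin 3) (LocalRing L v)))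
    (a b : ↥(unitaryGroupOfForm (conjLocal L (IsCMField.complexConj L) v) (cmLocalForm L 3 v))) (u u' : r.V) :
    ∫ n, B u' (r.ρ (a * (w * (n : ↥(unitaryGroupOfForm (conjLocal L (IsCMField.complexConj L) v) (cmLocalForm L 3 v))) * w⁻¹) * t *
      (w * (n : ↥(unitaryGroupOfForm (conjLocal L (IsCMField.complexConj L) v) (cmLocalForm L 3 v))) * w⁻¹)⁻¹ * b) u) ∂μN = 0 := by
  haveI : LocallyCompactSpace ↥(unitaryGroupOfForm (conjLocal L (IsCMField.complexConj L) v) (cmLocalForm L 3 v)) :=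
    locallyCompactSpace_local (IsCMField.complexConj L) 3 _ v
  haveI : SecondCountableTopology ↥(unitaryGroupOfForm (conjLocal L (IsCMField.complexConj L) v) (cmLocalForm L 3 v)) :=
    secondCountableTopology_local (IsCMField.complexConj L) 3 _ v
  haveI : SecondCountableTopology (LocalRing L v) := secondCountableTopology_localRing (E := L) v
  letI : MeasurableSpace (LocalRing L v) := borel _
  haveI : BorelSpace (LocalRing L v) := ⟨rfl⟩
  letI : Invertible (2 : LocalRing L v) := (isUnit_two_localRing L v).invertible
  have hreg'' : IsRegularElt (glDiagonal 3 (LocalRing L v) d') := by rw [hd']; exact hreg'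
  have ha' : IsUnit ((((d' 0)⁻¹ * d' 1 : (LocalRing L v)ˣ) : LocalRing L v) - 1) :=
    isUnit_coe_inv_mul_sub_one (F0P3cStCharTSWeylHypFibre.isUnit_sub_of_isRegularElt_glDiagonal hreg'' (by decide))
  have hb' : IsUnit ((((d' 0)⁻¹ * d' 2 : (LocalRing L v)ˣ) : LocalRing L v) - 1) :=
    isUnit_coe_inv_mul_sub_one (F0P3cStCharTSWeylHypFibre.isUnit_sub_of_isRegularElt_glDiagonal hreg'' (by decide))
  have ht' : t' ∈ torusU (conjLocal L (IsCMField.complexConj L) v) (cmLocalForm L 3 v) := (mem_torusU_iff t').2 ⟨d', hd'⟩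
  exact integral_conj_conj_unipotentU_eq_zero_of_forall_integral_eq_zero (conjLocal L (IsCMField.complexConj L) v) (conjLocal_conjLocal_cm L v)
    (continuous_conjLocal L (IsCMField.complexConj L) v) (cmLocalForm_eq_over L 3 v) μN t w ⟨t', ht'⟩ hw hd' ha' hb' (fun g => B u' (r.ρ g u))
    (fun a' b' => integral_coeff_translate_cmBorelN_eq_zero_of_isSupercuspidal L v hns μN r hsc B hBinv a' b' u u')
    (fun a' b' => aestronglyMeasurable_coeff_translate_cmBorelN L v μN r B a' b' u u') a b

/-! ### The slice package `f_t(x) := B u' (ρ(x t x⁻¹) u) ∈ Φ_C` (print's (i), (ii) with `A := T`) -/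

/-- **(Φ_C, continuity)** the slice `x ↦ B u' (ρ(x t x⁻¹) u)` is continuous (the coefficient is locally constant, ★
`Representation.IsSmooth.isLocallyConstant_apply`; conjugation is continuous). [cite: Casselman1995, Prop. 1.4.4] -/
theorem continuous_coeff_conj (r : SmoothIrrep ↥(unitaryGroupOfForm (conjLocal L (IsCMField.complexConj L) v) (cmLocalForm L 3 v)))
    (B : r.V →ₗ⋆[ℂ] r.V →ₗ[ℂ] ℂ) (t : ↥(unitaryGroupOfForm (conjLocal L (IsCMField.complexConj L) v) (cmLocalForm L 3 v))) (u u' : r.V) :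
    Continuous fun x : ↥(unitaryGroupOfForm (conjLocal L (IsCMField.complexConj L) v) (cmLocalForm L 3 v)) => B u' (r.ρ (x * t * x⁻¹) u) :=
  (((Representation.IsSmooth.isLocallyConstant_apply r.ρ r.isSmooth u).comp fun w : r.V => B u' w).continuous).comp
    ((continuous_id.mul continuous_const).mul continuous_inv)

/-- **(Φ_C (i), right-`T`-invariance)** `f_t(x z) = f_t(x)` for `z ∈ T` and `t = diag d` REGULAR (`Z(t) = T`, ★
`mem_torusU_iff_mem_centralizer_of_isUnit_sub`). [cite: HarishChandra1970, Part VII §2 p. 70 (i)] [cite: Rogawski1990, §3.6 p. 31] -/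
theorem coeff_conj_mul_eq_of_mem_torusU (r : SmoothIrrep ↥(unitaryGroupOfForm (conjLocal L (IsCMField.complexConj L) v) (cmLocalForm L 3 v)))
    (B : r.V →ₗ⋆[ℂ] r.V →ₗ[ℂ] ℂ) (t : ↥(unitaryGroupOfForm (conjLocal L (IsCMField.complexConj L) v) (cmLocalForm L 3 v)))
    {d : Fin 3 → (LocalRing L v)ˣ} (hd : glDiagonal 3 (LocalRing L v) d = (t : GL (Fin 3) (LocalRing L v)))
    (hreg : IsRegularElt (t : GL (Fin 3) (LocalRing L v))) (u u' : r.V)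
    (x : ↥(unitaryGroupOfForm (conjLocal L (IsCMField.complexConj L) v) (cmLocalForm L 3 v)))
    {z : ↥(unitaryGroupOfForm (conjLocal L (IsCMField.complexConj L) v) (cmLocalForm L 3 v))}
    (hz : z ∈ torusU (conjLocal L (IsCMField.complexConj L) v) (cmLocalForm L 3 v)) :
    B u' (r.ρ (x * z * t * (x * z)⁻¹) u) = B u' (r.ρ (x * t * x⁻¹) u) := by
  have hreg' : IsRegularElt (glDiagonal 3 (LocalRing L v) d) := by rw [hd]; exact hreg
  have hzc : z ∈ Subgroup.centralizer ({t} : Set ↥(unitaryGroupOfForm (conjLocal L (IsCMField.complexConj L) v) (cmLocalForm L 3 v))) :=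
    (mem_torusU_iff_mem_centralizer_of_isUnit_sub hd
      (fun i j hij => F0P3cStCharTSWeylHypFibre.isUnit_sub_of_isRegularElt_glDiagonal hreg' hij) z).1 hz
  exact apply_mul_conj_eq_of_commute (fun g => B u' (r.ρ g u)) t x z (Subgroup.mem_centralizer_singleton_iff.1 hzc)

set_option synthInstance.maxHeartbeats 400000 in
set_option maxHeartbeats 1600000 in
-- instance-term unification on the CM local carriers
/-- **(Φ_C (ii), `N`-cuspidality of the slice)** `∫_N f_t(x n) dn = 0` for every `x` (the head at `(x, x⁻¹)`).
[cite: HarishChandra1970, Part VII §2 p. 70 (ii)] -/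
theorem integral_coeff_slice_cmBorelN_eq_zero_of_isSupercuspidal (hns : ∀ w : PlacesOver L v, IsCMField.complexConj L • w.1 = w.1)
    [MeasurableSpace ↥(cmBorelTriple L 3 v).N] [BorelSpace ↥(cmBorelTriple L 3 v).N]
    (μN : Measure ↥(cmBorelTriple L 3 v).N) [IsHaarMeasure μN]
    (r : SmoothIrrep ↥(unitaryGroupOfForm (conjLocal L (IsCMField.complexConj L) v) (cmLocalForm L 3 v))) (hsc : r.ρ.IsSupercuspidal)
    (B : r.V →ₗ⋆[ℂ] r.V →ₗ[ℂ] ℂ)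
    (hBinv : ∀ (g : ↥(unitaryGroupOfForm (conjLocal L (IsCMField.complexConj L) v) (cmLocalForm L 3 v))) (x y : r.V), B (r.ρ g x) (r.ρ g y) = B x y)
    (t : ↥(unitaryGroupOfForm (conjLocal L (IsCMField.complexConj L) v) (cmLocalForm L 3 v))) {d : Fin 3 → (LocalRing L v)ˣ}
    (hd : glDiagonal 3 (LocalRing L v) d = (t : GL (Fin 3) (LocalRing L v))) (hreg : IsRegularElt (t : GL (Fin 3) (LocalRing L v)))
    (u u' : r.V) (x : ↥(unitaryGroupOfForm (conjLocal L (IsCMField.complexConj L) v) (cmLocalForm L 3 v))) :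
    ∫ n, B u' (r.ρ (x * (n : ↥(unitaryGroupOfForm (conjLocal L (IsCMField.complexConj L) v) (cmLocalForm L 3 v))) * t *
      (x * (n : ↥(unitaryGroupOfForm (conjLocal L (IsCMField.complexConj L) v) (cmLocalForm L 3 v))))⁻¹) u) ∂μN = 0 := by
  have h := integral_coeff_conj_cmBorelN_eq_zero_of_isSupercuspidal L v hns μN r hsc B hBinv t hd hreg x x⁻¹ u u'
  have heq : (fun n : ↥(cmBorelTriple L 3 v).N => B u' (r.ρ (x * (n : ↥(unitaryGroupOfForm (conjLocal L (IsCMField.complexConj L) v) (cmLocalForm L 3 v))) * t *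
      (x * (n : ↥(unitaryGroupOfForm (conjLocal L (IsCMField.complexConj L) v) (cmLocalForm L 3 v))))⁻¹) u)) =
      fun n : ↥(cmBorelTriple L 3 v).N => B u' (r.ρ (x * ((n : ↥(unitaryGroupOfForm (conjLocal L (IsCMField.complexConj L) v) (cmLocalForm L 3 v))) * t *
        (n : ↥(unitaryGroupOfForm (conjLocal L (IsCMField.complexConj L) v) (cmLocalForm L 3 v)))⁻¹) * x⁻¹) u) := by
    funext n; congr 2; group
  rw [heq]; exact h

set_option synthInstance.maxHeartbeats 400000 in
set_option maxHeartbeats 1600000 in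
-- instance-term unification on the CM local carriers
/-- **(Φ_C (i), support `⊆ C·T`)** for `θ = B u' (ρ(·) u)` a supercuspidal coefficient (compact support, ★ `hasCompactSupport_sesqForm_apply_apply`, compact
centre ★ `isCompact_center_cmLocal_of_nonsplit`) and `t = diag d` REGULAR: `∃ C` compact with `f_t(x) ≠ 0 ⇒ x ∈ C·T` — Harish-Chandra's Lemma 14 (★
`isCompact_image_mk_setOf_exists_conj_mem_cmDatum_local` at `K = {t}`, `C = tsupport θ`), read through §1 and `Z(t) = T` (★
`mem_torusU_iff_mem_centralizer_of_isUnit_sub`). [cite: HarishChandra1970, Part I §3 Lemma 14 p. 9; Part VII §2 p. 70 (i)] [cite: Rogawski1990, §4.9 p. 54] -/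
theorem exists_isCompact_support_coeff_conj_subset_mul_torusU (hns : ∀ w : PlacesOver L v, IsCMField.complexConj L • w.1 = w.1)
    (r : SmoothIrrep ↥(unitaryGroupOfForm (conjLocal L (IsCMField.complexConj L) v) (cmLocalForm L 3 v))) (hsc : r.ρ.IsSupercuspidal)
    (B : r.V →ₗ⋆[ℂ] r.V →ₗ[ℂ] ℂ)
    (hBinv : ∀ (g : ↥(unitaryGroupOfForm (conjLocal L (IsCMField.complexConj L) v) (cmLocalForm L 3 v))) (x y : r.V), B (r.ρ g x) (r.ρ g y) = B x y)
    (t : ↥(unitaryGroupOfForm (conjLocal L (IsCMField.complexConj L) v) (cmLocalForm L 3 v))) {d : Fin 3 → (LocalRing L v)ˣ}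
    (hd : glDiagonal 3 (LocalRing L v) d = (t : GL (Fin 3) (LocalRing L v))) (hreg : IsRegularElt (t : GL (Fin 3) (LocalRing L v)))
    (u u' : r.V) :
    ∃ C : Set ↥(unitaryGroupOfForm (conjLocal L (IsCMField.complexConj L) v) (cmLocalForm L 3 v)), IsCompact C ∧
      ∀ x : ↥(unitaryGroupOfForm (conjLocal L (IsCMField.complexConj L) v) (cmLocalForm L 3 v)), B u' (r.ρ (x * t * x⁻¹) u) ≠ 0 →
        x ∈ C * (torusU (conjLocal L (IsCMField.complexConj L) v) (cmLocalForm L 3 v) :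
          Set ↥(unitaryGroupOfForm (conjLocal L (IsCMField.complexConj L) v) (cmLocalForm L 3 v))) := by
  obtain ⟨w⟩ : Nonempty (PlacesOver L v) := inferInstance
  haveI : LocallyCompactSpace (GL (Fin 3) (w.1.adicCompletion L)) := locallyCompactSpace_gl_adicCompletion L 3 w.1
  haveI : SecondCountableTopology (GL (Fin 3) (w.1.adicCompletion L)) := secondCountableTopology_gl_adicCompletion L 3 w.1
  haveI : LocallyCompactSpace ↥(unitaryGroupOfForm (conjLocal L (IsCMField.complexConj L) v) (cmLocalForm L 3 v)) :=
    locallyCompactSpace_local (IsCMField.complexConj L) 3 _ v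
  have hreg' : IsRegularElt (glDiagonal 3 (LocalRing L v) d) := by rw [hd]; exact hreg
  -- the coefficient has compact support (compact centre at a non-split place)
  have hθ : HasCompactSupport fun g : ↥(unitaryGroupOfForm (conjLocal L (IsCMField.complexConj L) v) (cmLocalForm L 3 v)) => B u' (r.ρ g u) :=
    hsc.hasCompactSupport_sesqForm_apply_apply (F0P3bCentralCharacterUnitaryNonsplit.isCompact_center_cmLocal_of_nonsplit L 3 v hns) r.isSmooth hBinv u u'
  -- Harish-Chandra's Lemma 14 at `K = {t}`, `C = tsupport θ`
  have hA := isCompact_image_mk_setOf_exists_conj_mem_cmDatum_local L 3 (Matrix.of fun i j : Fin 3 => if i.val + j.val + 1 = 3 then (1 : L) else 0)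
    (antidiagOne_isHermitian L 3) (isUnit_antidiagOne_det L 3) w (hns w) t hreg isCompact_singleton
    (Set.singleton_subset_iff.2 (Subgroup.mem_centralizer_singleton_iff.2 rfl)) (fun t' ht' => by rw [Set.mem_singleton_iff.1 ht']; exact hreg)
    hθ.isCompact
  have hS : IsCompact ((QuotientGroup.mk : ↥(unitaryGroupOfForm (conjLocal L (IsCMField.complexConj L) v) (cmLocalForm L 3 v)) →
      ↥(unitaryGroupOfForm (conjLocal L (IsCMField.complexConj L) v) (cmLocalForm L 3 v)) ⧸
        Subgroup.centralizer ({t} : Set ↥(unitaryGroupOfForm (conjLocal L (IsCMField.complexConj L) v) (cmLocalForm L 3 v)))) ''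
      {x | x * t * x⁻¹ ∈ tsupport fun g : ↥(unitaryGroupOfForm (conjLocal L (IsCMField.complexConj L) v) (cmLocalForm L 3 v)) => B u' (r.ρ g u)}) := by
    have hset : {x : ↥(unitaryGroupOfForm (conjLocal L (IsCMField.complexConj L) v) (cmLocalForm L 3 v)) |
        ∃ t' ∈ ({t} : Set ↥(unitaryGroupOfForm (conjLocal L (IsCMField.complexConj L) v) (cmLocalForm L 3 v))),
          x * t' * x⁻¹ ∈ tsupport fun g : ↥(unitaryGroupOfForm (conjLocal L (IsCMField.complexConj L) v) (cmLocalForm L 3 v)) => B u' (r.ρ g u)} =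
        {x | x * t * x⁻¹ ∈ tsupport fun g : ↥(unitaryGroupOfForm (conjLocal L (IsCMField.complexConj L) v) (cmLocalForm L 3 v)) => B u' (r.ρ g u)} := by
      ext x; simp only [Set.mem_setOf_eq, Set.mem_singleton_iff, exists_eq_left]
    rw [← hset]; exact hA
  obtain ⟨C, hC, hsub⟩ := exists_isCompact_subset_mul_of_isCompact_image_mk (Subgroup.centralizer {t}) hS
  have hT : torusU (conjLocal L (IsCMField.complexConj L) v) (cmLocalForm L 3 v) =
      Subgroup.centralizer ({t} : Set ↥(unitaryGroupOfForm (conjLocal L (IsCMField.complexConj L) v) (cmLocalForm L 3 v))) :=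
    Subgroup.ext fun g => mem_torusU_iff_mem_centralizer_of_isUnit_sub hd
      (fun i j hij => F0P3cStCharTSWeylHypFibre.isUnit_sub_of_isRegularElt_glDiagonal hreg' hij) g
  refine ⟨C, hC, fun x hx => ?_⟩
  rw [hT]
  exact hsub (subset_tsupport _ (Function.mem_support.2 hx))

end CM

end Summit.HodgeConjecture.HodgeConjecture.Cruxes.H413.K2E3SupercuspOrbitalSliceCuspidal

end
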